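import Summits.QuantumFields.YangMills.Theorems.ParabolicTrajectoryLatticeGapOnTrajectorySparseDefectDefs
import HarnessLib

/-!
# Crux `LatticeGapOnTrajectory` (stmt-QuantumFields-10523), line `sparse-defect-orbit-window` (SketchIdeator5-r2):
# the annealed engine GENERALISES the landed sup-form engine (sanity of the registered stub's type)

`SparseDefectEngine → KREngine`: a sup-form Kantorovich–Rubinstein window (`IsKRWindow`, contraction for ALL
boundary data) is a typical window for the trivial good family `good := univ` with any bound `A` on the profile
entries (`IsTypicalKRWindow.of_isKRWindow`, Defs p127447), its bad events are empty, so hereditary and state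
sparseness hold at level `ε = 0`, and the smallness `ε (1 + A) ≤ c₀` is free; the annealed engine's `(κ, C₀)` do
not depend on `(A, ε)`, hence serve as the sup-form engine's constants. So the registered stub
`stub_sparseDefectEngine` is at least as strong as the landed `stub_krFiniteSizeDecay` (p95465) — its type is not a
weakening in disguise — and a refutation of it must use genuinely bad data.

References: Dobrushin–Shlosman 1985; Föllmer 1988 Ch. I §2.
-/

set_option autoImplicit false

noncomputable section

namespace Summit.QuantumFields.YangMills.Cruxes.LatticeGapOnTrajectory.SparseDefectOrbitWindow

open scoped BigOperators ENNReal
open MeasureTheory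
open Literature.Probability.LatticeModels (Specification IsSpecification IsGibbsMeasure)
open Summit.QuantumFields.YangMills.Cruxes.LatticeGapOnTrajectory.OrbitKantorovichFiniteSize

section Trivial

variable {μ : Fin 4 → ℕ} {V S : Type} [Fintype V] [MeasurableSpace S]

/-- With every datum good, no configuration is bad on a nonempty set of cells: hereditary sparseness at level `0`. -/
theorem hereditarySparse_univ (cell : V → CoarseIdx μ) (γ : Specification V S) (hγ : IsSpecification γ) (n : ℕ) :
    HereditarySparse cell γ n (fun _ => Set.univ) 0 := by
  intro c ω _ X _
  by_cases hX : X = ∅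
  · subst hX
    haveI := hγ.isProbability (windowVol cell n c) ω
    simp
  · obtain ⟨x, hx⟩ := Finset.nonempty_iff_ne_empty.2 hX
    have hempty : {σ : V → S | ∀ y ∈ X, σ ∉ (fun _ : CoarseIdx μ => (Set.univ : Set (V → S))) y} = ∅ :=
      Set.eq_empty_iff_forall_notMem.2 fun σ hσ => hσ x hx (Set.mem_univ σ)
    rw [hempty, measure_empty]
    exact bot_le

omit [Fintype V] in
/-- With every datum good, state sparseness at level `0` holds for every probability measure. -/
theorem sparseUnder_univ (ν : Measure (V → S)) [IsProbabilityMeasure ν] :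
    SparseUnder (μ := μ) ν (fun _ => Set.univ) 0 := by
  intro X
  by_cases hX : X = ∅
  · subst hX
    simp
  · obtain ⟨x, hx⟩ := Finset.nonempty_iff_ne_empty.2 hX
    have hempty : {σ : V → S | ∀ y ∈ X, σ ∉ (fun _ : CoarseIdx μ => (Set.univ : Set (V → S))) y} = ∅ :=
      Set.eq_empty_iff_forall_notMem.2 fun σ hσ => hσ x hx (Set.mem_univ σ)
    rw [hempty, measure_empty]
    exact bot_le

end Trivial

/-- **The annealed sparse-defect engine implies the landed sup-form engine** (`kREngine_of_sparseDefectEngine`):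
instantiate the typical package at `good := univ`, `A := Σ`-free bound `max 0 (sup k)` replaced by the explicit
bound `B := ∑_{c,y,x} k c y x` on the (finitely many, nonnegative) profile entries, and `ε := 0`.
[cite: DobrushinShlosman1985, Theorem] [cite: Follmer1988, Ch. I Theorem (2.13)] -/
theorem kREngine_of_sparseDefectEngine (hE : SparseDefectEngine) : KREngine := by
  intro n γ₀ R hγ₀ hγ₁ hR
  obtain ⟨κ, C₀, c₀, hκ, hC₀, hc₀, hEng⟩ := hE n γ₀ R hγ₀ hγ₁ hR
  refine ⟨κ, C₀, hκ, hC₀, ?_⟩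
  intro μ V S _ _ cell w γ k hμ hγ hKR ν hν f g Δf Δg δf δg D hf hg hfb hgb hfd hgd hLf hLg hD
  classical
  -- a bound on the finitely many nonnegative profile entries
  set B : ℝ := ∑ c : CoarseIdx μ, ∑ y : CoarseIdx μ, ∑ x : CoarseIdx μ, k c y x with hB
  have hk0 : ∀ c y x, 0 ≤ k c y x := hKR.k_nonneg
  have hkB : ∀ c y x, k c y x ≤ B := by
    intro c y x
    calc k c y x ≤ ∑ x' : CoarseIdx μ, k c y x' :=
          Finset.single_le_sum (f := fun x' => k c y x') (fun x' _ => hk0 c y x') (Finset.mem_univ x)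
      _ ≤ ∑ y' : CoarseIdx μ, ∑ x' : CoarseIdx μ, k c y' x' :=
          Finset.single_le_sum (f := fun y' => ∑ x' : CoarseIdx μ, k c y' x')
            (fun y' _ => Finset.sum_nonneg fun x' _ => hk0 c y' x') (Finset.mem_univ y)
      _ ≤ B := Finset.single_le_sum (f := fun c' => ∑ y' : CoarseIdx μ, ∑ x' : CoarseIdx μ, k c' y' x')
            (fun c' _ => Finset.sum_nonneg fun y' _ => Finset.sum_nonneg fun x' _ => hk0 c' y' x')
            (Finset.mem_univ c)
  have hB0 : 0 ≤ B :=
    Finset.sum_nonneg fun c _ => Finset.sum_nonneg fun y _ => Finset.sum_nonneg fun x _ => hk0 c y x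
  haveI : IsProbabilityMeasure ν := hν.1
  exact hEng B 0 le_rfl (by simpa using hc₀.le) μ V S cell w γ k (fun _ => Set.univ) hμ hγ
    (IsTypicalKRWindow.of_isKRWindow hKR hkB hB0) (hereditarySparse_univ cell γ hγ n) ν hν
    (sparseUnder_univ ν) f g Δf Δg δf δg D hf hg hfb hgb hfd hgd hLf hLg hD

end Summit.QuantumFields.YangMills.Cruxes.LatticeGapOnTrajectory.SparseDefectOrbitWindow

end
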